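import Summits.QuantumFields.YangMills.Theorems.ColdStartUniversalityLatticeLangevinBakryEmeryKLDecay
import Summits.QuantumFields.YangMills.Theorems.ColdStartUniversalityLatticeLangevinLawDensityBound
import Summits.QuantumFields.YangMills.Theorems.ColdStartUniversalityKLDivDensityBound
import HarnessLib

/-!
# Route `ColdStartUniversality` (fixed-cut-off package, entropy side): the SHARP ENTROPY BUDGET `KL(ν ‖ μ) ≤ log D` under a density bound,
# and the cold-start KL budget + volume-uniform decay for the SU(2) SZZ dynamics

Helper file (seat `ym-line-csu-p1`, g26; `--supports stmt-QuantumFields-24809`).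
* ★ `klDiv_le_log_of_le_smul` — route-independent: for probability measures `ν ≤ D·μ` (`D ≥ 1`), `KL(ν ‖ μ) ≤ log D`
  (`dν/dμ ≤ D` a.e., `p log p ≤ p log D`, `∫ p dμ = 1`); sharpens g10's `klDiv_le_of_le_smul` (`max(1, log D)·(D + 1)`).
* ★ `wilson_klDiv_map_le_log` — SU(2) SZZ dynamics at `(L, β')`: for every start `z` and lattice time `t₁ > 0` there is `D ≥ 1` with
  `KL(law(U_(t₁+s)) ‖ μ_(β')) ≤ log D` for EVERY solution `U` from `z` on ANY probability space and every `s ≥ 0` (the density bound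
  `map_le_smul_haar_of_le` + the Haar/Wilson comparison `wilsonMeasure_le_smul_pi_haar_and`);
* ★★ `wilson_coldStart_klDiv_le_exp_uniform` — at `|β'| < 1/12`: `KL(law(U_(t₁+u)) ‖ μ_(β')) ≤ e^(−2(1−12|β'|)u) · log D` for all `u ≥ 0`
  (`wilson_klDiv_map_le_exp_uniform`): volume-uniform RATE, start-dependent budget `log D = log D(L, β', z, t₁)`.
HONEST FRAMING: FIXED cut-off; `D` is only known to exist (not explicit in `L`), so no «mixing time `O(log volume)`» is claimed; nothing
K-uniform; 24809 ASIDE not restated; no crux, rung or summit statement is proved; the Yang–Mills mass gap is NOT proved.  THEOREMS ONLY, no sorry.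
-/

set_option autoImplicit false

noncomputable section

namespace Summit.QuantumFields.YangMills.Theorems.ColdStartUniversality

open MeasureTheory ProbabilityTheory Finset Filter Set InformationTheory
open scoped BigOperators NNReal ENNReal Topology
open Literature.Probability.Process Literature.MathematicalPhysics.QuantumFieldTheory
open Literature.MathematicalPhysics.QuantumLattice (fundamentalRep fundamentalLatticeRep continuous_fundamentalRep)

/-! ## §1. `KL(ν ‖ μ) ≤ log D` under `ν ≤ D·μ` -/

/-- ★ **Sharp entropy budget under a density bound**: for probability measures `ν ≤ D·μ` with `D ≥ 1`, `KL(ν ‖ μ) ≤ log D`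
(`p = dν/dμ ≤ D` a.e., `p log p ≤ p log D`, `∫ p dμ = 1`). [folklore] -/
theorem klDiv_le_log_of_le_smul {α : Type*} [MeasurableSpace α] {ν μ : Measure α} [IsProbabilityMeasure ν] [IsProbabilityMeasure μ]
    {D : ℝ} (hD : 1 ≤ D) (h : ν ≤ (ENNReal.ofReal D) • μ) :
    klDiv ν μ ≤ ENNReal.ofReal (Real.log D) := by
  have hac : ν ≪ μ := Measure.absolutelyContinuous_of_le_smul h
  rw [klDiv_eq_lintegral_klFun_of_ac hac]
  have hbd := KLDensity.rnDeriv_le_const_of_le_smul h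
  have hpm : Measurable fun x => (ν.rnDeriv μ x).toReal := (ν.measurable_rnDeriv μ).ennreal_toReal
  have hpi : Integrable (fun x => (ν.rnDeriv μ x).toReal) μ := Measure.integrable_toReal_rnDeriv
  have hp1 : ∫ x, (ν.rnDeriv μ x).toReal ∂μ = 1 := by
    rw [Measure.integral_toReal_rnDeriv hac]
    simp
  have hlogD : 0 ≤ Real.log D := Real.log_nonneg hD
  -- pointwise: `klFun p ≤ p log D + 1 − p`
  have hpt : ∀ᵐ x ∂μ, klFun (ν.rnDeriv μ x).toReal ≤ (ν.rnDeriv μ x).toReal * Real.log D + 1 - (ν.rnDeriv μ x).toReal := by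
    filter_upwards [hbd] with x hx
    have hx0 : 0 ≤ (ν.rnDeriv μ x).toReal := ENNReal.toReal_nonneg
    have hxD : (ν.rnDeriv μ x).toReal ≤ D := ENNReal.toReal_le_of_le_ofReal (by linarith) hx
    rw [klFun_apply]
    have hlog : (ν.rnDeriv μ x).toReal * Real.log (ν.rnDeriv μ x).toReal ≤ (ν.rnDeriv μ x).toReal * Real.log D := by
      rcases hx0.eq_or_lt with h0 | hpos
      · rw [← h0]; simp
      · exact mul_le_mul_of_nonneg_left (Real.log_le_log hpos hxD) hx0
    linarith
  have hnn : 0 ≤ᵐ[μ] fun x => (ν.rnDeriv μ x).toReal * Real.log D + 1 - (ν.rnDeriv μ x).toReal := by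
    filter_upwards [hpt] with x hx
    exact (klFun_nonneg ENNReal.toReal_nonneg).trans hx
  have hi : Integrable (fun x => (ν.rnDeriv μ x).toReal * Real.log D + 1 - (ν.rnDeriv μ x).toReal) μ :=
    ((hpi.mul_const _).add (integrable_const _)).sub hpi
  calc ∫⁻ x, ENNReal.ofReal (klFun (ν.rnDeriv μ x).toReal) ∂μ
      ≤ ∫⁻ x, ENNReal.ofReal ((ν.rnDeriv μ x).toReal * Real.log D + 1 - (ν.rnDeriv μ x).toReal) ∂μ :=
        lintegral_mono_ae (hpt.mono fun x hx => ENNReal.ofReal_le_ofReal hx)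
    _ = ENNReal.ofReal (∫ x, ((ν.rnDeriv μ x).toReal * Real.log D + 1 - (ν.rnDeriv μ x).toReal) ∂μ) :=
        (ofReal_integral_eq_lintegral_ofReal hi hnn).symm
    _ = ENNReal.ofReal (Real.log D) := by
        congr 1
        have hi1 : Integrable (fun x => (ν.rnDeriv μ x).toReal * Real.log D) μ := hpi.mul_const _
        have hi2 : Integrable (fun x => (ν.rnDeriv μ x).toReal * Real.log D + 1) μ := hi1.add (integrable_const _)
        rw [integral_sub hi2 hpi, integral_add hi1 (integrable_const _), integral_mul_const, hp1]
        simp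

/-! ## §2. The cold-start KL budget and its volume-uniform decay -/

variable {L : ℕ} [NeZero L]

/-- ★ **Cold-start entropy budget after a positive time** (SU(2) SZZ dynamics at `(L, β')`): for every start `z` and `t₁ > 0` there is
`D ≥ 1` such that EVERY solution `U` from `z` on ANY probability space satisfies `KL(law(U_(t₁+s)) ‖ μ_(β')) ≤ log D` for all `s ≥ 0`
(`law(U_t) ≤ C·Haar^⊗E ≤ C·a·μ_(β')` and `klDiv_le_log_of_le_smul`). [folklore] -/
theorem wilson_klDiv_map_le_log (L : ℕ) [NeZero L] (β' : ℝ) (z : (GaugeConfig 3 L (Matrix.specialUnitaryGroup (Fin 2) ℂ))) {t₁ : ℝ≥0} (ht₁ : 0 < (t₁ : ℝ)) :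
    ∃ D : ℝ, 1 ≤ D ∧ ∀ {Ω : Type} [MeasurableSpace Ω] {P : Measure Ω} [IsProbabilityMeasure P]
      {W : ℝ≥0 → Ω → (Edge 3 L × NoiseIdx 2 → ℝ)} (hW : IsFlatBrownian W P)
      {U : ℝ≥0 → Ω → (GaugeConfig 3 L (Matrix.specialUnitaryGroup (Fin 2) ℂ))}, (∀ ω, U 0 ω = z) →
      (latticeLangevinDynamics (fundamentalLatticeRep 2) β').IsSolution (fundamentalRep (Fin 2)) hW.natFiltration P W U →
      ∀ s : ℝ≥0, klDiv (P.map (U (t₁ + s))) (wilsonMeasure (d := 3) (L := L) (fundamentalRep (Fin 2)) β') ≤ ENNReal.ofReal (Real.log D) := by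
  classical
  haveI := secondCountableTopology_su2
  haveI := borelSpace_config L
  haveI : IsProbabilityMeasure (wilsonMeasure (d := 3) (L := L) (fundamentalRep (Fin 2)) β') :=
    isProbabilityMeasure_wilsonMeasure (d := 3) (L := L) (fundamentalRep (Fin 2)) (continuous_fundamentalRep (Fin 2)) β'
  obtain ⟨C, hC0, hC⟩ := map_le_smul_haar_of_le (L := L) β' ht₁ z
  obtain ⟨a, ha, -, hπμ⟩ := wilsonMeasure_le_smul_pi_haar_and (L := L) β'
  refine ⟨max 1 (C * a), le_max_left _ _, @fun Ω _ P _ W hW U hU0 hU s => ?_⟩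
  have hmU : ∀ t : ℝ≥0, Measurable (U t) := fun t => (hU.adapted t).mono (hW.natFiltration.le t) le_rfl
  haveI : IsProbabilityMeasure (P.map (U (t₁ + s))) := Measure.isProbabilityMeasure_map (hmU _).aemeasurable
  have h1 := hC hW hU0 hU s
  -- `law ≤ C·π ≤ (C·a)·μ ≤ D·μ`
  have h2 : P.map (U (t₁ + s)) ≤ (ENNReal.ofReal (max 1 (C * a))) • (wilsonMeasure (d := 3) (L := L) (fundamentalRep (Fin 2)) β') := by
    rw [Measure.le_iff]
    intro S hS
    have e1 := (Measure.le_iff.1 h1) S hS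
    have e2 := (Measure.le_iff.1 hπμ) S hS
    simp only [Measure.smul_apply, smul_eq_mul] at e1 e2 ⊢
    calc P.map (U (t₁ + s)) S ≤ ENNReal.ofReal C * (Measure.pi fun _ : Edge 3 L => haarProbability (Matrix.specialUnitaryGroup (Fin 2) ℂ)) S := e1
      _ ≤ ENNReal.ofReal C * (ENNReal.ofReal a * (wilsonMeasure (d := 3) (L := L) (fundamentalRep (Fin 2)) β') S) := mul_le_mul' le_rfl e2
      _ = ENNReal.ofReal (C * a) * (wilsonMeasure (d := 3) (L := L) (fundamentalRep (Fin 2)) β') S := by rw [← mul_assoc, ← ENNReal.ofReal_mul hC0]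
      _ ≤ ENNReal.ofReal (max 1 (C * a)) * (wilsonMeasure (d := 3) (L := L) (fundamentalRep (Fin 2)) β') S := mul_le_mul' (ENNReal.ofReal_le_ofReal (le_max_right _ _)) le_rfl
  exact klDiv_le_log_of_le_smul (le_max_left _ _) h2

/-- ★★ **Volume-uniform decay of the cold-start relative entropy at `|β'| < 1/12`**: for every start `z` and `t₁ > 0` there is `D ≥ 1` with
`KL(law(U_(t₁+u)) ‖ μ_(β')) ≤ e^(−2(1−12|β'|)u)·log D` for every solution `U` from `z` and every `u ≥ 0` — rate independent of `L`, budget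
`log D` start- and volume-dependent (existential here). [cite: ShenZhuZhu2022, §4 Theorem 4.2] -/
theorem wilson_coldStart_klDiv_le_exp_uniform (L : ℕ) [NeZero L] (β' : ℝ) (hβ : |β'| < 1 / 12) (z : (GaugeConfig 3 L (Matrix.specialUnitaryGroup (Fin 2) ℂ))) {t₁ : ℝ≥0} (ht₁ : 0 < (t₁ : ℝ)) :
    ∃ D : ℝ, 1 ≤ D ∧ ∀ {Ω : Type} [MeasurableSpace Ω] {P : Measure Ω} [IsProbabilityMeasure P]
      {W : ℝ≥0 → Ω → (Edge 3 L × NoiseIdx 2 → ℝ)} (hW : IsFlatBrownian W P)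
      {U : ℝ≥0 → Ω → (GaugeConfig 3 L (Matrix.specialUnitaryGroup (Fin 2) ℂ))}, (∀ ω, U 0 ω = z) →
      (latticeLangevinDynamics (fundamentalLatticeRep 2) β').IsSolution (fundamentalRep (Fin 2)) hW.natFiltration P W U →
      ∀ u : ℝ≥0, klDiv (P.map (U (t₁ + u))) (wilsonMeasure (d := 3) (L := L) (fundamentalRep (Fin 2)) β') ≤
        ENNReal.ofReal (Real.exp (-(2 * (1 - 12 * |β'|)) * u) * Real.log D) := by
  obtain ⟨D, hD, hbud⟩ := wilson_klDiv_map_le_log L β' z ht₁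
  refine ⟨D, hD, @fun Ω _ P _ W hW U hU0 hU u => ?_⟩
  have hdec := wilson_klDiv_map_le_exp_uniform L β' hβ hW z hU0 hU ht₁ u
  have hb := hbud hW hU0 hU 0
  rw [add_zero] at hb
  have hlogD : 0 ≤ Real.log D := Real.log_nonneg hD
  have hK : (klDiv (P.map (U t₁)) (wilsonMeasure (d := 3) (L := L) (fundamentalRep (Fin 2)) β')).toReal ≤ Real.log D := by
    have h := ENNReal.toReal_mono ENNReal.ofReal_ne_top hb
    rwa [ENNReal.toReal_ofReal hlogD] at h
  refine hdec.trans (ENNReal.ofReal_le_ofReal ?_)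
  exact mul_le_mul_of_nonneg_left hK (Real.exp_pos _).le

end Summit.QuantumFields.YangMills.Theorems.ColdStartUniversality
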